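import Mathlib
import HarnessLib
import Summits.ResolutionOfSingularities.ResolutionOfSingularities.Theorems.WildQuotientsWildQuotientResolutionJordanFourCover
import Summits.ResolutionOfSingularities.ResolutionOfSingularities.Theorems.WildQuotientsWildQuotientResolutionJordanFourChartWDefs
import Summits.ResolutionOfSingularities.ResolutionOfSingularities.Theorems.WildQuotientsWildQuotientResolutionToricExitJordanThreeBrickNonempty
import Literature.AlgebraicGeometry.Resolution.AffineBlowupCartier
import Literature.AlgebraicGeometry.Resolution.BlowupPrincipalCharts

/-!
# Programme V4U, brick `Hcov`: `Bl_{I₆} 𝔸ⁿ = V[x_a²] ∪ W_T ∪ V[x_c⁶]` — the twisted root chart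
# `W_T = D₊(T′t · H′³t²)` and the two outer vertex charts cover the blow-up

(crux stmt-ResolutionOfSingularities-15640 `WildQuotients.WildQuotientResolution`, line `Sketch`;
chain w45c programme V4U, `L/w45c/CHAIN.md` v7.4 §4, brick `Hcov` of the scaffold
`JordanFour.jordanFour_hasResolution_of_bricks` (p501160), ORDER res-L1-w45c-plan-1 RULING v7.4 (2)
2026-08-27T06:08:48Z → res-type-036; design `L/w45c/V4U-DESIGN.md` §3/§5; route of record =
res-L1-w45c-tri-2 `V4U-XCHECK-2.md` §3 (scheme-theoretic radical argument); [OURS · L1 W4.5c] — NOT a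
statement of any manuscript; replaces the role of no printed item.)

`I₆ = (x_a², x_a x_b², x_a x_b x_c, x_a x_c³, x_b³, x_b² x_c², x_b x_c⁴, x_c⁶) ⊆ k[x]` (generators
`g₀, …, g₇`), `V = Bl_{I₆} 𝔸ⁿ = Proj k[x][I₆ t]`, `T′ = x_b³ − 3x_a x_b x_c + 3x_a² x_d − x_a² x_b`,
`H′ = x_b² − x_a x_b − 2x_a x_c` (res-L1-w45c-stub-1, `…JordanFourTwistedChartDefs`), and the W TERM
OF RECORD `JordanFour.chartW = D₊(T′t · H′³t²)` with `hCubeT2 = H′³t²` (res-L1-w45c-stub-5,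
`…JordanFourChartWDefs`, p504103; = res-L1-w45c-stub-2's `W_T`).

§1 is GENERIC (any commutative ring `R`, ideal `I`, elements `x_a, x_b, x_c, x_d` with the relevant
memberships among `x_a², x_a x_b², x_a x_b x_c, x_a x_c³, x_b³, x_b² x_c² ∈ I`, Rees elements `T`, `H`
with underlying polynomials `T′t`, `H′³t²`):
* `ReesCover.reesT_one_cube`, `ReesCover.reesT_two_sq` — `(x_a x_b² t)³ = x_a·(x_a²t)(x_b³t)²`,
  `(x_a x_b x_c t)² = (x_a²t)(x_b²x_c²t)`;
* `ReesCover.reesT_mul_eq` — ONE identity in `R[It]`: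
  `T·H = (x_b³t)³ + (x_a²t)·A − (x_a x_b² t)·(3(x_b³t)²) − (x_a x_b x_c t)·(6(x_b³t)² + 3H)`, `A` explicit
  (`T′ = x_b³ − 3·x_a x_b x_c + (3x_d − x_b)·x_a²` and res-L1-w45c-plan-1's cofactor table `mem2_Hcube`;
  = `V4U-XCHECK-2.md` §3 (α); = res-type-029's factor table 2026-08-27T05:48:35Z);
* `ReesCover.reesT_cube_mem_of_mem` — for a prime `𝔭 ⊆ R[It]`: `x_a²t ∈ 𝔭` and `T·H ∈ 𝔭` force
  `x_b³t ∈ 𝔭` (the two power identities, the identity, primality).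
§2 instantiates at the `J₄` vector of record:
* `basicOpen_I6_four_le_basicOpen_zero_sup_chartW` — `D₊(x_b³t) ⊆ D₊(x_a²t) ∪ W_T`;
* `basicOpen_zero_sup_chartW_sup_basicOpen_seven_eq_top` — with the vertex-chart cover
  `D₊(x_a²t) ∪ D₊(x_b³t) ∪ D₊(x_c⁶t) = V` (`JordanFour.iSup_vertexCharts_I6_eq_top`, `…JordanFourCover`):
  **`D₊(x_a²t) ∪ W_T ∪ D₊(x_c⁶t) = V`**, scheme-theoretically, over any field, no hypothesis;
* `blowupChart_sup_chartW_sup_blowupChart_eq_top` — the same in the LITERAL form of the scaffold's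
  binder `Hcov` (Literature principal charts `blowupChart π Ĩ₆ ⊤ x_a²`, `blowupChart π Ĩ₆ ⊤ x_c⁶`, via
  `BlowupExit.affineBlowup_chartOpen_le_blowupChart`, p498242, and `affineBlowup.image_top_chartι`),
  at `W := JordanFour.chartW k n a b c d`.
-/

-- single-problem summit: the doubled namespace component `ResolutionOfSingularities` is forced
set_option linter.dupNamespace false

noncomputable section

open MvPolynomial AlgebraicGeometry Literature.AlgebraicGeometry.Resolution

namespace Summit.ResolutionOfSingularities.ResolutionOfSingularities.Theorems.WildQuotientResolution.JordanFour

/-! ## §1 Generic Rees-algebra bookkeeping -/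

namespace ReesCover

variable {R : Type*} [CommRing R] {I : Ideal R} (xa xb xc xd : R)

/-- `(x_a x_b² t)³ = x_a·(x_a² t)(x_b³ t)²` in `R[It]`. [OURS · L1 W4.5c] [folklore] -/
theorem reesT_one_cube (h0 : xa ^ 2 ∈ I) (h1 : xa * xb ^ 2 ∈ I) (h4 : xb ^ 3 ∈ I) :
    reesT (xa * xb ^ 2) h1 ^ 3 = xa • (reesT (xa ^ 2) h0 * reesT (xb ^ 3) h4 ^ 2) := by
  apply Subtype.ext
  simp only [Subalgebra.coe_pow, Subalgebra.coe_mul, Subalgebra.coe_smul, coe_reesT,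
    Polynomial.monomial_pow, Polynomial.monomial_mul_monomial, Polynomial.smul_monomial, smul_eq_mul]
  congr 1
  ring

/-- `(x_a x_b x_c t)² = (x_a² t)(x_b² x_c² t)` in `R[It]`. [OURS · L1 W4.5c] [folklore] -/
theorem reesT_two_sq (h0 : xa ^ 2 ∈ I) (h2 : xa * xb * xc ∈ I) (h5 : xb ^ 2 * xc ^ 2 ∈ I) :
    reesT (xa * xb * xc) h2 ^ 2 = reesT (xa ^ 2) h0 * reesT (xb ^ 2 * xc ^ 2) h5 := by
  apply Subtype.ext
  simp only [Subalgebra.coe_pow, Subalgebra.coe_mul, coe_reesT,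
    Polynomial.monomial_pow, Polynomial.monomial_mul_monomial]
  congr 1
  ring

/-- **The Rees identity behind the cover.** For Rees elements `T = T′t` and `H = H′³t²`:
`T·H = (x_b³t)³ + (x_a²t)·A − (x_a x_b² t)·(3(x_b³t)²) − (x_a x_b x_c t)·(6(x_b³t)² + 3H)` with
`A = (3x_d − x_b)·H + (x_b³t)·((3x_b + 12x_c)·x_b³t + 12·x_b²x_c²t − (x_b + 6x_c)·x_a x_b² t − 12x_c·x_a x_b x_c t
− 8·x_a x_c³ t)`. [OURS · L1 W4.5c] [folklore] -/
theorem reesT_mul_eq (h0 : xa ^ 2 ∈ I) (h1 : xa * xb ^ 2 ∈ I) (h2 : xa * xb * xc ∈ I)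
    (h3 : xa * xc ^ 3 ∈ I) (h4 : xb ^ 3 ∈ I) (h5 : xb ^ 2 * xc ^ 2 ∈ I) (T H : reesAlgebra I)
    (hT : (T : Polynomial R) =
      Polynomial.monomial 1 (xb ^ 3 - 3 * (xa * xb * xc) + 3 * (xa ^ 2 * xd) - xa ^ 2 * xb))
    (hH : (H : Polynomial R) = Polynomial.monomial 2 ((xb ^ 2 - xa * xb - 2 * (xa * xc)) ^ 3)) :
    T * H = reesT (xb ^ 3) h4 ^ 3
      + reesT (xa ^ 2) h0 * ((3 * xd - xb) • H
          + reesT (xb ^ 3) h4 * ((3 * xb + 12 * xc) • reesT (xb ^ 3) h4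
            + (12 : R) • reesT (xb ^ 2 * xc ^ 2) h5
            - (xb + 6 * xc) • reesT (xa * xb ^ 2) h1
            - (12 * xc) • reesT (xa * xb * xc) h2
            - (8 : R) • reesT (xa * xc ^ 3) h3))
      - reesT (xa * xb ^ 2) h1 * ((3 : R) • reesT (xb ^ 3) h4 ^ 2)
      - reesT (xa * xb * xc) h2 * ((6 : R) • reesT (xb ^ 3) h4 ^ 2 + (3 : R) • H) := by
  apply Subtype.ext
  simp only [Subalgebra.coe_mul, Subalgebra.coe_add, Subalgebra.coe_sub, Subalgebra.coe_pow,
    Subalgebra.coe_smul, coe_reesT, hT, hH, Polynomial.smul_eq_C_mul,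
    ← Polynomial.C_mul_X_pow_eq_monomial, map_add, map_sub, map_mul, map_pow, map_ofNat]
  ring

/-- **`x_a²t ∈ 𝔭 ∧ T′t·H′³t² ∈ 𝔭 ⇒ x_b³t ∈ 𝔭`** for every prime `𝔭` of `R[It]`: `x_a²t ∈ 𝔭` gives
`x_a x_b² t, x_a x_b x_c t ∈ 𝔭` (`reesT_one_cube`, `reesT_two_sq`), and then `(x_b³t)³ ∈ 𝔭` by
`reesT_mul_eq`. [OURS · L1 W4.5c] [folklore] -/
theorem reesT_cube_mem_of_mem (h0 : xa ^ 2 ∈ I) (h1 : xa * xb ^ 2 ∈ I) (h2 : xa * xb * xc ∈ I)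
    (h3 : xa * xc ^ 3 ∈ I) (h4 : xb ^ 3 ∈ I) (h5 : xb ^ 2 * xc ^ 2 ∈ I) (T H : reesAlgebra I)
    (hT : (T : Polynomial R) =
      Polynomial.monomial 1 (xb ^ 3 - 3 * (xa * xb * xc) + 3 * (xa ^ 2 * xd) - xa ^ 2 * xb))
    (hH : (H : Polynomial R) = Polynomial.monomial 2 ((xb ^ 2 - xa * xb - 2 * (xa * xc)) ^ 3))
    {P : Ideal (reesAlgebra I)} [hP : P.IsPrime]
    (hP0 : reesT (xa ^ 2) h0 ∈ P) (hPW : T * H ∈ P) :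
    reesT (xb ^ 3) h4 ∈ P := by
  have hP1 : reesT (xa * xb ^ 2) h1 ∈ P := by
    refine hP.mem_of_pow_mem 3 ?_
    rw [reesT_one_cube xa xb h0 h1 h4]
    exact Submodule.smul_of_tower_mem _ _ (Ideal.mul_mem_right _ _ hP0)
  have hP2 : reesT (xa * xb * xc) h2 ∈ P := by
    refine hP.mem_of_pow_mem 2 ?_
    rw [reesT_two_sq xa xb xc h0 h2 h5]
    exact Ideal.mul_mem_right _ _ hP0
  refine hP.mem_of_pow_mem 3 ?_
  have e := reesT_mul_eq xa xb xc xd h0 h1 h2 h3 h4 h5 T H hT hH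
  rw [show reesT (xb ^ 3) h4 ^ 3 = T * H
      - reesT (xa ^ 2) h0 * ((3 * xd - xb) • H
          + reesT (xb ^ 3) h4 * ((3 * xb + 12 * xc) • reesT (xb ^ 3) h4
            + (12 : R) • reesT (xb ^ 2 * xc ^ 2) h5
            - (xb + 6 * xc) • reesT (xa * xb ^ 2) h1
            - (12 * xc) • reesT (xa * xb * xc) h2
            - (8 : R) • reesT (xa * xc ^ 3) h3))
      + reesT (xa * xb ^ 2) h1 * ((3 : R) • reesT (xb ^ 3) h4 ^ 2)
      + reesT (xa * xb * xc) h2 * ((6 : R) • reesT (xb ^ 3) h4 ^ 2 + (3 : R) • H) by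
    rw [e]; ring]
  exact Ideal.add_mem _ (Ideal.add_mem _ (Ideal.sub_mem _ hPW (Ideal.mul_mem_right _ _ hP0))
    (Ideal.mul_mem_right _ _ hP1)) (Ideal.mul_mem_right _ _ hP2)

end ReesCover

/-! ## §2 The `J₄` instance: the cover by `V[x_a²]`, `W_T`, `V[x_c⁶]` -/

variable (k : Type) [Field k] (n : ℕ) (a b c d : Fin n)

/-- **`D₊(x_b³t) ⊆ D₊(x_a²t) ∪ W_T`**: off the `μ₃`-vertex chart, the twisted root chart contains
the `μ₂`-vertex chart (`ReesCover.reesT_cube_mem_of_mem` at the point's homogeneous prime).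
[OURS · L1 W4.5c] [folklore] -/
theorem basicOpen_I6_four_le_basicOpen_zero_sup_chartW :
    Proj.basicOpen (reesGrading (Ideal.span (Set.range
        (![X a ^ 2, X a * X b ^ 2, X a * X b * X c, X a * X c ^ 3, X b ^ 3, X b ^ 2 * X c ^ 2,
          X b * X c ^ 4, X c ^ 6] : Fin 8 → MvPolynomial (Fin n) k)))) (reesT ((![X a ^ 2, X a * X b ^ 2, X a * X b * X c, X a * X c ^ 3, X b ^ 3, X b ^ 2 * X c ^ 2,
          X b * X c ^ 4, X c ^ 6] : Fin 8 → MvPolynomial (Fin n) k) 4) (Ideal.mem_span_range_self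
        (f := (![X a ^ 2, X a * X b ^ 2, X a * X b * X c, X a * X c ^ 3, X b ^ 3, X b ^ 2 * X c ^ 2,
          X b * X c ^ 4, X c ^ 6] : Fin 8 → MvPolynomial (Fin n) k)) (x := 4))) ≤ Proj.basicOpen (reesGrading (Ideal.span (Set.range
        (![X a ^ 2, X a * X b ^ 2, X a * X b * X c, X a * X c ^ 3, X b ^ 3, X b ^ 2 * X c ^ 2,
          X b * X c ^ 4, X c ^ 6] : Fin 8 → MvPolynomial (Fin n) k)))) (reesT ((![X a ^ 2, X a * X b ^ 2, X a * X b * X c, X a * X c ^ 3, X b ^ 3, X b ^ 2 * X c ^ 2,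
          X b * X c ^ 4, X c ^ 6] : Fin 8 → MvPolynomial (Fin n) k) 0) (Ideal.mem_span_range_self
        (f := (![X a ^ 2, X a * X b ^ 2, X a * X b * X c, X a * X c ^ 3, X b ^ 3, X b ^ 2 * X c ^ 2,
          X b * X c ^ 4, X c ^ 6] : Fin 8 → MvPolynomial (Fin n) k)) (x := 0))) ⊔ chartW k n a b c d := by
  intro x hx
  rw [TopologicalSpace.Opens.mem_sup]
  by_contra h
  rw [not_or] at h
  simp only [chartW, Proj.mem_basicOpen, not_not] at h hx
  refine hx ?_
  rw [← HomogeneousIdeal.mem_iff] at hx ⊢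
  have h0 := (HomogeneousIdeal.mem_iff (I := x.asHomogeneousIdeal)).mpr h.1
  have hW := (HomogeneousIdeal.mem_iff (I := x.asHomogeneousIdeal)).mpr h.2
  exact ReesCover.reesT_cube_mem_of_mem (X a) (X b) (X c) (X d)
    (Ideal.mem_span_range_self (f := (![X a ^ 2, X a * X b ^ 2, X a * X b * X c, X a * X c ^ 3, X b ^ 3, X b ^ 2 * X c ^ 2,
          X b * X c ^ 4, X c ^ 6] : Fin 8 → MvPolynomial (Fin n) k)) (x := 0))
    (Ideal.mem_span_range_self (f := (![X a ^ 2, X a * X b ^ 2, X a * X b * X c, X a * X c ^ 3, X b ^ 3, X b ^ 2 * X c ^ 2,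
          X b * X c ^ 4, X c ^ 6] : Fin 8 → MvPolynomial (Fin n) k)) (x := 1))
    (Ideal.mem_span_range_self (f := (![X a ^ 2, X a * X b ^ 2, X a * X b * X c, X a * X c ^ 3, X b ^ 3, X b ^ 2 * X c ^ 2,
          X b * X c ^ 4, X c ^ 6] : Fin 8 → MvPolynomial (Fin n) k)) (x := 2))
    (Ideal.mem_span_range_self (f := (![X a ^ 2, X a * X b ^ 2, X a * X b * X c, X a * X c ^ 3, X b ^ 3, X b ^ 2 * X c ^ 2,
          X b * X c ^ 4, X c ^ 6] : Fin 8 → MvPolynomial (Fin n) k)) (x := 3))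
    (Ideal.mem_span_range_self (f := (![X a ^ 2, X a * X b ^ 2, X a * X b * X c, X a * X c ^ 3, X b ^ 3, X b ^ 2 * X c ^ 2,
          X b * X c ^ 4, X c ^ 6] : Fin 8 → MvPolynomial (Fin n) k)) (x := 4))
    (Ideal.mem_span_range_self (f := (![X a ^ 2, X a * X b ^ 2, X a * X b * X c, X a * X c ^ 3, X b ^ 3, X b ^ 2 * X c ^ 2,
          X b * X c ^ 4, X c ^ 6] : Fin 8 → MvPolynomial (Fin n) k)) (x := 5))
    (reesT (tPrime k n a b c d) (tPrime_mem_I6 k n a b c d)) (hCubeT2 k n a b c) rfl rfl h0 hW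

/-- **`Bl_{I₆} 𝔸ⁿ = D₊(x_a²t) ∪ W_T ∪ D₊(x_c⁶t)`** — the `μ₃`-vertex chart, the twisted root chart
and the smooth vertex chart cover the blow-up (scheme-theoretically, any field, no hypothesis; from
the vertex-chart cover `JordanFour.iSup_vertexCharts_I6_eq_top` and
`basicOpen_I6_four_le_basicOpen_zero_sup_chartW`). [OURS · L1 W4.5c] [folklore] -/
theorem basicOpen_zero_sup_chartW_sup_basicOpen_seven_eq_top :
    Proj.basicOpen (reesGrading (Ideal.span (Set.range
        (![X a ^ 2, X a * X b ^ 2, X a * X b * X c, X a * X c ^ 3, X b ^ 3, X b ^ 2 * X c ^ 2,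
          X b * X c ^ 4, X c ^ 6] : Fin 8 → MvPolynomial (Fin n) k)))) (reesT ((![X a ^ 2, X a * X b ^ 2, X a * X b * X c, X a * X c ^ 3, X b ^ 3, X b ^ 2 * X c ^ 2,
          X b * X c ^ 4, X c ^ 6] : Fin 8 → MvPolynomial (Fin n) k) 0) (Ideal.mem_span_range_self
        (f := (![X a ^ 2, X a * X b ^ 2, X a * X b * X c, X a * X c ^ 3, X b ^ 3, X b ^ 2 * X c ^ 2,
          X b * X c ^ 4, X c ^ 6] : Fin 8 → MvPolynomial (Fin n) k)) (x := 0))) ⊔ chartW k n a b c d ⊔ Proj.basicOpen (reesGrading (Ideal.span (Set.range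
        (![X a ^ 2, X a * X b ^ 2, X a * X b * X c, X a * X c ^ 3, X b ^ 3, X b ^ 2 * X c ^ 2,
          X b * X c ^ 4, X c ^ 6] : Fin 8 → MvPolynomial (Fin n) k)))) (reesT ((![X a ^ 2, X a * X b ^ 2, X a * X b * X c, X a * X c ^ 3, X b ^ 3, X b ^ 2 * X c ^ 2,
          X b * X c ^ 4, X c ^ 6] : Fin 8 → MvPolynomial (Fin n) k) 7) (Ideal.mem_span_range_self
        (f := (![X a ^ 2, X a * X b ^ 2, X a * X b * X c, X a * X c ^ 3, X b ^ 3, X b ^ 2 * X c ^ 2,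
          X b * X c ^ 4, X c ^ 6] : Fin 8 → MvPolynomial (Fin n) k)) (x := 7))) = ⊤ := by
  refine top_le_iff.mp ?_
  rw [← iSup_vertexCharts_I6_eq_top k n a b c]
  exact sup_le (sup_le (le_sup_left.trans le_sup_left)
    ((basicOpen_I6_four_le_basicOpen_zero_sup_chartW k n a b c d).trans le_sup_left)) le_sup_right

/-- **Brick `Hcov` of the V4U scaffold, literal form**: with the Literature principal charts
`V[x_a²] = blowupChart π Ĩ₆ ⊤ x_a²` and `V[x_c⁶] = blowupChart π Ĩ₆ ⊤ x_c⁶` of `π : Bl_{I₆} 𝔸ⁿ → 𝔸ⁿ`: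
**`V[x_a²] ⊔ W_T ⊔ V[x_c⁶] = ⊤`** (each Rees chart `D₊(g t)` lies in the principal chart `V[g]`,
`BlowupExit.affineBlowup_chartOpen_le_blowupChart`). This is the hypothesis `Hcov` of
`JordanFour.jordanFour_hasResolution_of_bricks` (p501160) at `W := chartW k n a b c d`.
[OURS · L1 W4.5c] [folklore] -/
theorem blowupChart_sup_chartW_sup_blowupChart_eq_top :
    blowupChart (affineBlowup.π (Ideal.span (Set.range
        (![X a ^ 2, X a * X b ^ 2, X a * X b * X c, X a * X c ^ 3, X b ^ 3, X b ^ 2 * X c ^ 2,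
          X b * X c ^ 4, X c ^ 6] : Fin 8 → MvPolynomial (Fin n) k)))) (affineBlowup.idealSheaf (Ideal.span (Set.range
        (![X a ^ 2, X a * X b ^ 2, X a * X b * X c, X a * X c ^ 3, X b ^ 3, X b ^ 2 * X c ^ 2,
          X b * X c ^ 4, X c ^ 6] : Fin 8 → MvPolynomial (Fin n) k)))) ⟨⊤, isAffineOpen_top _⟩
        ((Scheme.ΓSpecIso (CommRingCat.of (MvPolynomial (Fin n) k))).inv.hom (X a ^ 2)) ⊔
      chartW k n a b c d ⊔
      blowupChart (affineBlowup.π (Ideal.span (Set.range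
        (![X a ^ 2, X a * X b ^ 2, X a * X b * X c, X a * X c ^ 3, X b ^ 3, X b ^ 2 * X c ^ 2,
          X b * X c ^ 4, X c ^ 6] : Fin 8 → MvPolynomial (Fin n) k)))) (affineBlowup.idealSheaf (Ideal.span (Set.range
        (![X a ^ 2, X a * X b ^ 2, X a * X b * X c, X a * X c ^ 3, X b ^ 3, X b ^ 2 * X c ^ 2,
          X b * X c ^ 4, X c ^ 6] : Fin 8 → MvPolynomial (Fin n) k)))) ⟨⊤, isAffineOpen_top _⟩
        ((Scheme.ΓSpecIso (CommRingCat.of (MvPolynomial (Fin n) k))).inv.hom (X c ^ 6)) = ⊤ := by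
  refine top_le_iff.mp ?_
  rw [← basicOpen_zero_sup_chartW_sup_basicOpen_seven_eq_top k n a b c d]
  refine sup_le_sup (sup_le_sup ?_ le_rfl) ?_
  · rw [← affineBlowup.image_top_chartι]
    exact BlowupExit.affineBlowup_chartOpen_le_blowupChart _ _
  · rw [← affineBlowup.image_top_chartι]
    exact BlowupExit.affineBlowup_chartOpen_le_blowupChart _ _

end Summit.ResolutionOfSingularities.ResolutionOfSingularities.Theorems.WildQuotientResolution.JordanFour

end
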